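import Literature.Barriers.FinalStateConjecture.TrappingDerivativeLossEnergy
import Literature.Geometry.Lorentzian.KerrEnergyIdentity
import Literature.Geometry.Lorentzian.KerrSchildSlabDivergence
import HarnessLib

/-!
# Sbierski's Kerr trapping theorem: the coordinate-energy beams (B) from "weak beams" by
# approximate conservation of the `∂_{t*}`-energy off the ergoregion
(companion file of `Literature/Barriers/FinalStateConjecture/TrappingDerivativeLoss.lean`; family
`gr`, summit `FinalStateConjecture`; namespace `Literature.Barriers.FinalStateConjecture`)

`TrappingDerivativeLossInputs.lean` reduces the barrier `SbierskiTrappingObstruction` (Sbierski,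
Anal. PDE 8 (2015), Thm. 7.4 with Thm. 5.5/5.1) to (A) the Cauchy problem with the energy estimate
(`KerrWaveCauchyEnergyEstimate`, proved from `KerrSchild.waveCauchyProblem` in
`TrappingDerivativeLossEnergy.lean`) and (B) the coordinate-energy Gaussian beams
`SbierskiKerrGaussianBeams`: for every `T` and accuracy `ε` a `C^∞` approximate solution `u` of
`□_g u = 0` on the exterior chart, compactly supported, with `‖□_g u‖²_{L²(R_{[0,T]})} ≤ ε`,
bounded initial energy and local energy `≥ c > 0` on *all* slices `{t* = τ}`, `0 ≤ τ ≤ T`, with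
`c` independent of `T`. In the tree (B) is derived from the literal beam fact
`SbierskiKerrTrappedGeodesicBeams` (beams along the trapped geodesic of §7A *with* the geometric
characterisation of their `N`-energy, §4 of the paper = the canonical fact
`KerrNullGeodesicGaussianBeams`), the characterisation of §4 being what supplies the lower bound
at the later times.

This file proves that **§4 is not needed for (B) on Kerr**: it suffices to have *weak beams* —
approximate solutions satisfying only the three conditions of the proof of Thm. 2.1 (§3, Lemma 2.2
of the arXiv text: `‖□ũ_λ‖_{L²(R_{[0,T]})} → 0` after the normalisation `ũ_λ = u_λ/√E₀`, and
support in a prescribed neighbourhood of the geodesic), with a two-sided bound on the *initial*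
coordinate energy only — provided the supports stay in `{r ≥ r₁}` for some `r₁ > 2M`, which is the
case for beams along the retrograde equatorial photon orbit `r₀ ∈ [3M, 4M]` used in the tree
(`Kerr.photonOrbitRadius`). The lower bound at later times then comes from the **approximate
conservation of the energy of the stationary Killing field `T = ∂_{t*}`**, which is timelike on
`{r > 2M}` (`g(T, T) = −1 + 2H`, `H ≤ M/r`): this is the shortcut Sbierski points out for
Schwarzschild (§1.2, last paragraph: "in the presence of a globally timelike Killing vector field
one can already infer such obstructions from (1.2), since the (canonical) energy of solutions to
the wave equation is then constant"), and it applies on Kerr to functions supported off the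
ergoregion because only the region `supp u` enters the energy identity.

## Contents (all proved; no named facts are introduced)

* `neg_tCurrent_zero_eq`, `sub_scalarH_mul_sum_sq_le_neg_tCurrent_zero`,
  `neg_tCurrent_zero_le_sum_sq` — the density `−(J^T)⁰ = ½(1 + 2H)p₀² + ½|p⃗|² − H(ℓ⃗·p⃗)²` of the
  `∂_{t*}`-current `Kerr.tCurrent` (`KerrEnergyIdentity.lean`) through `{t* = const}` and the
  two-sided comparison `(½ − H) ∑p² ≤ −(J^T)⁰ ≤ ∑p²` (`0 ≤ H ≤ ½`).
* `contDiff_tCurrent`, `continuous_waveOperator_inverseMetric`,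
  `sum_fderiv_tCurrent_eq_waveOperator_mul`, `integral_tCurrent_sub_eq` — for `w ∈ C²(E4)` which
  near every point either vanishes identically or sits at positive Kerr–Schild radius (the zero
  extension of a function on the chart vanishing off a compact set), the current is `C¹`, its
  coordinate divergence is `(□_g w) ∂₀w` (`Kerr.sum_fderiv_tCurrent`, `K^T = 0`), and the
  integrated identity `∫ (J^T)⁰(t₁) − ∫ (J^T)⁰(t₀) = ∫_{(t₀,t₁]} ∫ □_g w ∂₀w` holds
  (`E4.integral_sub_eq_integral_divergence`, `KerrSchildSlabDivergence.lean`).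
* `sliceEnergy_lower_bound_of_tEnergy` — **the core estimate**: for such `w` supported in
  `{r ≥ r₁} ∩ {‖x⃗‖ ≤ ρ}`, `r₁ > 2M`, `κ = ½ − M/r₁`, `E(t) = ∫ ∑_μ (∂_μ w)²(t, y) dy`:
  if `∫_{(0,T]}∫ (□_g w)² ≤ μ`, `e₁ ≤ E(0)` and `μ (T + 1)(κ⁻² + ¼) ≤ κ e₁/2` then `E(τ) ≥ κ e₁/4`
  for `0 ≤ τ ≤ T` (Young's inequality and a bootstrap on `sup_{[0,T]} ∫ −(J^T)⁰`).
* `sliceEnergy_eq_ofReal_integral`, `localSliceEnergy_eq_sliceEnergy_of_support`,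
  `integral_waveOperator_sq_le_of_slabSqNorm_le` — the dictionary between the `[0, ∞]`-valued
  energies `sliceEnergy`, `localSliceEnergy`, `slabSqNorm` of the chart and real integrals of the
  zero extension (`Kerr.dalembertian_eq_divergence` for `□_g`).
* `SbierskiKerrGaussianBeams.of_weakBeams` — **(B) from weak beams**: `R₀ = R₁ + 1`,
  `c = (½ − M/r₁) e₁/4`, `C = e₂`, the accuracy `min (ε, μ₀(T))` chosen after `T`. With
  `SbierskiTrappingObstruction.of_waveCauchyProblem_of_gaussianBeams`
  (`TrappingDerivativeLossEnergy.lean`) the barrier therefore follows from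
  `KerrSchild.waveCauchyProblem` and weak beams along the photon orbit.

## References

* J. Sbierski, *Characterisation of the energy of Gaussian beams on Lorentzian manifolds: with
  applications to black hole spacetimes*, Anal. PDE 8 (2015) 1379–1420 (arXiv:1311.2477): §1.2
  (last paragraph: the Killing-energy shortcut), §2 = arXiv §2.1, proof of Thm. 2.1 (the three
  conditions (2.4)–(2.6) and the normalisation), §3 = arXiv §2.2, Lemma 2.2/Lemma 5 (key
  `Sbierski2015`).
* M. Dafermos, I. Rodnianski, Y. Shlapentokh-Rothman, arXiv:1402.7034 = Ann. of Math. 183 (2016),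
  §2.2.4 (the ergoregion), §2.3.1–§2.3.2 (`J^T`, `K^T = 0`, the divergence identity), §3.1
  (`J^N_μ n^μ ∼ ∑ (∂ψ)²`) (key `DafermosRodnianskiShlapentokhrothman2014`).
-/

noncomputable section

open Set Filter
open scoped Manifold ContDiff ENNReal Topology

namespace Literature.Barriers.FinalStateConjecture

open Literature.Geometry.Lorentzian
open _root_.MeasureTheory Metric

/-! ### The `∂_{t*}`-energy density off the ergoregion -/

/-- **Closed form of the `∂_{t*}`-energy density through the slices `{t* = const}`**: with
`p = dΦ(x)`, `H` the Kerr–Schild scalar and `ℓ⃗` the spatial part of the null covector,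
`−(J^T)⁰ = ½ (1 + 2H) p₀² + ½ |p⃗|² − H (ℓ⃗·p⃗)²` (`g^{μν} = η^{μν} − 2H ℓ^μ ℓ^ν`, `ℓ⁰ = −1`;
Dafermos–Rodnianski–Shlapentokh-Rothman arXiv:1402.7034, §2.3.1, `J^T_μ = T_{μν} T^ν`).
[cite: DafermosRodnianskiShlapentokhrothman2014, §2.3.1] -/
theorem neg_tCurrent_zero_eq (M a : ℝ) (Φ : E4 → ℝ) (x : E4) :
    -Kerr.tCurrent M a Φ x 0 =
      2⁻¹ * (1 + 2 * Kerr.scalarH M a x) * fderiv ℝ Φ x (E4.basisVector 0) ^ 2 +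
        2⁻¹ * (fderiv ℝ Φ x (E4.basisVector 1) ^ 2 + fderiv ℝ Φ x (E4.basisVector 2) ^ 2 +
          fderiv ℝ Φ x (E4.basisVector 3) ^ 2) -
        Kerr.scalarH M a x * (Kerr.nullCovectorFun a x 1 * fderiv ℝ Φ x (E4.basisVector 1) +
          Kerr.nullCovectorFun a x 2 * fderiv ℝ Φ x (E4.basisVector 2) +
          Kerr.nullCovectorFun a x 3 * fderiv ℝ Φ x (E4.basisVector 3)) ^ 2 := by
  unfold Kerr.tCurrent
  simp +decide only [Fin.sum_univ_four, Kerr.inverseMetric_apply, Kerr.nullVector_apply_zero,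
    Kerr.nullVector_apply_one, Kerr.nullVector_apply_two, Kerr.nullVector_apply_three,
    Fin.isValue, if_true, if_false]
  ring

/-- **Coercivity of the `∂_{t*}`-energy density off the ergoregion**: for `M ≥ 0` and `r > 0`,
`(½ − H) ∑_μ p_μ² ≤ −(J^T)⁰` (Lagrange's identity `(ℓ⃗·p⃗)² ≤ |ℓ⃗|²|p⃗|²`, `|ℓ⃗| = 1`). In
particular `−(J^T)⁰` is positive definite wherever `2H < 1`, i.e. where `∂_{t*}` is timelike
(`g(∂_{t*}, ∂_{t*}) = −1 + 2H`; the ergoregion `{2H ≥ 1}` lies in `{r ≤ 2M}` since `H ≤ M/r`).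
[cite: DafermosRodnianskiShlapentokhrothman2014, §2.2.4 and §3.1] -/
theorem sub_scalarH_mul_sum_sq_le_neg_tCurrent_zero {M : ℝ} (hM : 0 ≤ M) (a : ℝ) (Φ : E4 → ℝ)
    {x : E4} (hx : 0 < Kerr.radius a x) :
    (2⁻¹ - Kerr.scalarH M a x) * ∑ μ, fderiv ℝ Φ x (E4.basisVector μ) ^ 2 ≤
      -Kerr.tCurrent M a Φ x 0 := by
  rw [neg_tCurrent_zero_eq, Fin.sum_univ_four]
  have hH := Kerr.scalarH_nonneg hM a x
  have hl := Kerr.sum_sq_nullCovectorFun hx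
  set H := Kerr.scalarH M a x
  set l₁ := Kerr.nullCovectorFun a x 1
  set l₂ := Kerr.nullCovectorFun a x 2
  set l₃ := Kerr.nullCovectorFun a x 3
  set p₀ := fderiv ℝ Φ x (E4.basisVector 0)
  set p₁ := fderiv ℝ Φ x (E4.basisVector 1)
  set p₂ := fderiv ℝ Φ x (E4.basisVector 2)
  set p₃ := fderiv ℝ Φ x (E4.basisVector 3)
  -- Lagrange: `(ℓ⃗·p⃗)² ≤ |ℓ⃗|² |p⃗|² = |p⃗|²`
  have hlag : (l₁ * p₁ + l₂ * p₂ + l₃ * p₃) ^ 2 ≤ p₁ ^ 2 + p₂ ^ 2 + p₃ ^ 2 := by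
    nlinarith [sq_nonneg (l₁ * p₂ - l₂ * p₁), sq_nonneg (l₁ * p₃ - l₃ * p₁),
      sq_nonneg (l₂ * p₃ - l₃ * p₂)]
  nlinarith [mul_nonneg hH (sq_nonneg p₀), mul_nonneg hH (sub_nonneg.2 hlag)]

/-- **The trivial upper bound** `−(J^T)⁰ ≤ ∑_μ p_μ²` for `0 ≤ H ≤ ½`, `r > 0`.
[cite: DafermosRodnianskiShlapentokhrothman2014, §3.1] -/
theorem neg_tCurrent_zero_le_sum_sq {M : ℝ} (hM : 0 ≤ M) (a : ℝ) (Φ : E4 → ℝ) {x : E4}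
    (hx : 0 < Kerr.radius a x) (hH : Kerr.scalarH M a x ≤ 2⁻¹) :
    -Kerr.tCurrent M a Φ x 0 ≤ ∑ μ, fderiv ℝ Φ x (E4.basisVector μ) ^ 2 := by
  rw [neg_tCurrent_zero_eq, Fin.sum_univ_four]
  have hH0 := Kerr.scalarH_nonneg hM a x
  have hl := Kerr.sum_sq_nullCovectorFun hx
  set H := Kerr.scalarH M a x
  set l₁ := Kerr.nullCovectorFun a x 1
  set l₂ := Kerr.nullCovectorFun a x 2
  set l₃ := Kerr.nullCovectorFun a x 3
  set p₀ := fderiv ℝ Φ x (E4.basisVector 0)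
  set p₁ := fderiv ℝ Φ x (E4.basisVector 1)
  set p₂ := fderiv ℝ Φ x (E4.basisVector 2)
  set p₃ := fderiv ℝ Φ x (E4.basisVector 3)
  nlinarith [mul_nonneg hH0 (sq_nonneg (l₁ * p₁ + l₂ * p₂ + l₃ * p₃)),
    mul_nonneg (sub_nonneg.2 hH) (sq_nonneg p₀), sq_nonneg p₁, sq_nonneg p₂, sq_nonneg p₃]


/-! ### Regularity of the `∂_{t*}`-current and of the wave operator for chart-supported functions -/

section ChartSupported

variable {M a : ℝ} {w : E4 → ℝ}

/-- Local vanishing of a function propagates to its Fréchet derivative. [folklore] -/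
theorem fderiv_eventuallyEq_zero_of_eventuallyEq_zero {x : E4} (h : w =ᶠ[𝓝 x] fun _ ↦ 0) :
    (fun y ↦ fderiv ℝ w y) =ᶠ[𝓝 x] fun _ ↦ 0 := by
  obtain ⟨O, hOf, hO, hxO⟩ := _root_.eventually_nhds_iff.1 h
  filter_upwards [hO.mem_nhds hxO] with z hz
  exact fderiv_eq_zero_of_forall_mem_eq_zero hO hOf hz

/-- The `∂_{t*}`-current of a function vanishing near `x` vanishes near `x`. [folklore] -/
theorem tCurrent_eventuallyEq_zero {x : E4} (h : w =ᶠ[𝓝 x] fun _ ↦ 0) (μ : Fin 4) :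
    (fun y ↦ Kerr.tCurrent M a w y μ) =ᶠ[𝓝 x] fun _ ↦ 0 := by
  filter_upwards [fderiv_eventuallyEq_zero_of_eventuallyEq_zero h] with z hz
  simp [Kerr.tCurrent, hz]

/-- The wave operator of a function vanishing near `x` vanishes near `x`. [folklore] -/
theorem waveOperator_eventuallyEq_zero (G : E4 → Fin 4 → Fin 4 → ℝ) {x : E4}
    (h : w =ᶠ[𝓝 x] fun _ ↦ 0) :
    KerrSchild.waveOperator G w =ᶠ[𝓝 x] fun _ ↦ 0 := by
  obtain ⟨O, hOf, hO, hxO⟩ := _root_.eventually_nhds_iff.1 h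
  filter_upwards [hO.mem_nhds hxO] with z hz
  exact waveOperator_eq_zero_of_eventuallyEq_zero (Filter.eventually_of_mem (hO.mem_nhds hz) hOf)

/-- The `∂_{t*}`-current of a `C²` function is `C¹` at every point with `r > 0`. [folklore] -/
theorem contDiffAt_tCurrent (hw : ContDiff ℝ 2 w) {x : E4} (hx : 0 < Kerr.radius a x)
    (μ : Fin 4) : ContDiffAt ℝ 1 (fun y ↦ Kerr.tCurrent M a w y μ) x := by
  have hp : ∀ ν, ContDiffAt ℝ 1 (fun y ↦ fderiv ℝ w y (E4.basisVector ν)) x :=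
    fun ν ↦ (KerrSchild.Background.contDiff_partial hw _).contDiffAt
  have hg : ∀ α β, ContDiffAt ℝ 1 (fun y ↦ Kerr.inverseMetric M a y α β) x :=
    fun α β ↦ Kerr.contDiffAt_inverseMetric M a hx α β
  unfold Kerr.tCurrent
  exact ((ContDiffAt.sum fun ν _ ↦ (hg μ ν).mul (hp ν)).mul (hp 0)).sub
    (contDiffAt_const.mul (contDiffAt_const.mul
      (ContDiffAt.sum fun α _ ↦ ContDiffAt.sum fun β _ ↦ ((hg α β).mul (hp α)).mul (hp β))))

/-- **The `∂_{t*}`-current of a `C²` function which, near every point, either vanishes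
identically or sits at positive Kerr–Schild radius, is `C¹` on all of `E4`.** [folklore] -/
theorem contDiff_tCurrent (hw : ContDiff ℝ 2 w)
    (hloc : ∀ x, (w =ᶠ[𝓝 x] fun _ ↦ 0) ∨ 0 < Kerr.radius a x) (μ : Fin 4) :
    ContDiff ℝ 1 fun y ↦ Kerr.tCurrent M a w y μ := by
  refine contDiff_iff_contDiffAt.2 fun x ↦ ?_
  rcases hloc x with h | h
  · exact (contDiffAt_const (c := (0 : ℝ))).congr_of_eventuallyEq (tCurrent_eventuallyEq_zero h μ)
  · exact contDiffAt_tCurrent hw h μ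

/-- Under the same hypotheses the Kerr wave operator `□_g w = ∑_μ ∂_μ (g^{μν} ∂_ν w)` is
continuous on `E4`. [folklore] -/
theorem continuous_waveOperator_inverseMetric (hw : ContDiff ℝ 2 w)
    (hloc : ∀ x, (w =ᶠ[𝓝 x] fun _ ↦ 0) ∨ 0 < Kerr.radius a x) :
    Continuous (KerrSchild.waveOperator (Kerr.inverseMetric M a) w) := by
  refine continuous_iff_continuousAt.2 fun x ↦ ?_
  rcases hloc x with h | h
  · exact continuousAt_const.congr_of_eventuallyEq (waveOperator_eventuallyEq_zero _ h)
  · have hin : ∀ μ, ContDiffAt ℝ 1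
        (fun y ↦ ∑ ν, Kerr.inverseMetric M a y μ ν * fderiv ℝ w y (E4.basisVector ν)) x :=
      fun μ ↦ ContDiffAt.sum fun ν _ ↦ (Kerr.contDiffAt_inverseMetric M a h μ ν).mul
        (KerrSchild.Background.contDiff_partial hw _).contDiffAt
    have hμ : ∀ μ, ContinuousAt (fun y ↦ fderiv ℝ
        (fun y ↦ ∑ ν, Kerr.inverseMetric M a y μ ν * fderiv ℝ w y (E4.basisVector ν)) y
          (E4.basisVector μ)) x :=
      fun μ ↦ ((hin μ).continuousAt_fderiv one_ne_zero).clm_apply continuousAt_const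
    unfold KerrSchild.waveOperator
    exact tendsto_finsetSum _ fun μ _ ↦ hμ μ

/-- **Pointwise conservation law**: `∑_μ ∂_μ (J^T)^μ = (□_g w) ∂₀w` at every point, for `w` as
above (at points of positive radius this is `Kerr.sum_fderiv_tCurrent`; near the other points
both sides vanish identically). [cite: DafermosRodnianskiShlapentokhrothman2014, §2.3.2] -/
theorem sum_fderiv_tCurrent_eq_waveOperator_mul (hw : ContDiff ℝ 2 w)
    (hloc : ∀ x, (w =ᶠ[𝓝 x] fun _ ↦ 0) ∨ 0 < Kerr.radius a x) (x : E4) :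
    ∑ μ, fderiv ℝ (fun y ↦ Kerr.tCurrent M a w y μ) x (E4.basisVector μ) =
      KerrSchild.waveOperator (Kerr.inverseMetric M a) w x *
        fderiv ℝ w x (E4.basisVector 0) := by
  rcases hloc x with h | h
  · have h0 : ∀ μ, fderiv ℝ (fun y ↦ Kerr.tCurrent M a w y μ) x = 0 := fun μ ↦ by
      rw [(tCurrent_eventuallyEq_zero h μ).fderiv_eq]; simp
    have hw0 : fderiv ℝ w x = 0 := by
      rw [(show w =ᶠ[𝓝 x] fun _ ↦ 0 from h).fderiv_eq]; simp
    simp [h0, hw0]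
  · exact Kerr.sum_fderiv_tCurrent M a h hw.contDiffAt

/-- **The integrated energy identity for the Killing multiplier `∂_{t*}` on Kerr**: for `w` as
above with `dw = 0` on `{‖x⃗‖ > ρ}`,
`∫ (J^T)⁰(t₁, y) dy − ∫ (J^T)⁰(t₀, y) dy = ∫_{(t₀, t₁]} ∫ (□_g w ∂₀w)(t, y) dy dt`
(`K^T = 0`: Dafermos–Rodnianski–Shlapentokh-Rothman §2.3.2; Sbierski, proof of Thm. 2.1, for the
Killing case "there is a canonical energy which is conserved"). [cite: Sbierski2015, §1.2 and §2 proof of Thm. 2.1] -/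
theorem integral_tCurrent_sub_eq (hw : ContDiff ℝ 2 w)
    (hloc : ∀ x, (w =ᶠ[𝓝 x] fun _ ↦ 0) ∨ 0 < Kerr.radius a x) {ρ : ℝ}
    (hfar : ∀ x : E4, ρ < E4.spatialNorm x → fderiv ℝ w x = 0) {t₀ t₁ : ℝ} (h01 : t₀ ≤ t₁) :
    (∫ y, Kerr.tCurrent M a w (E4.ofTimeSpace t₁ y) 0) -
        ∫ y, Kerr.tCurrent M a w (E4.ofTimeSpace t₀ y) 0 =
      ∫ t in Set.Ioc t₀ t₁, ∫ y,
        KerrSchild.waveOperator (Kerr.inverseMetric M a) w (E4.ofTimeSpace t y) *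
          fderiv ℝ w (E4.ofTimeSpace t y) (E4.basisVector 0) := by
  have h := E4.integral_sub_eq_integral_divergence (J := fun μ x ↦ Kerr.tCurrent M a w x μ)
    (contDiff_tCurrent hw hloc) h01 (ρ := ρ) fun μ t _ y hy ↦ by
      have hd : fderiv ℝ w (E4.ofTimeSpace t y) = 0 := hfar _ (by simpa using hy)
      simp [Kerr.tCurrent, hd]
  rw [h]
  refine setIntegral_congr_fun measurableSet_Ioc fun t _ ↦ ?_
  exact congrArg (fun f : E3 → ℝ ↦ ∫ y, f y)
    (funext fun y ↦ sum_fderiv_tCurrent_eq_waveOperator_mul hw hloc _)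

end ChartSupported


/-! ### Slice integrals of continuous functions with spatially bounded support -/

section Slices

/-- A continuous function on `E4` vanishing on `{‖x⃗‖ > ρ}` is integrable on every slice
`{t} × E3`. [folklore] -/
theorem integrable_slice {f : E4 → ℝ} (hf : Continuous f) {ρ : ℝ}
    (h0 : ∀ x, ρ < E4.spatialNorm x → f x = 0) (t : ℝ) :
    Integrable fun y : E3 ↦ f (E4.ofTimeSpace t y) := by
  refine (hf.comp (E4.continuous_ofTimeSpace t)).integrable_of_hasCompactSupport ?_
  refine HasCompactSupport.intro (isCompact_closedBall (0 : E3) ρ) fun y hy ↦ ?_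
  rw [Metric.mem_closedBall, dist_zero_right, not_le] at hy
  exact h0 _ (by simpa using hy)

/-- The slice integral of such a function is the integral over the ball `{‖y‖ ≤ ρ}`. [folklore] -/
theorem integral_slice_eq_setIntegral {f : E4 → ℝ} {ρ : ℝ}
    (h0 : ∀ x, ρ < E4.spatialNorm x → f x = 0) (t : ℝ) :
    ∫ y, f (E4.ofTimeSpace t y) = ∫ y in closedBall (0 : E3) ρ, f (E4.ofTimeSpace t y) := by
  refine (setIntegral_eq_integral_of_forall_compl_eq_zero fun y hy ↦ ?_).symm
  rw [Metric.mem_closedBall, dist_zero_right, not_le] at hy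
  exact h0 _ (by simpa using hy)

/-- The slice integrals of such a function depend continuously on the time. [folklore] -/
theorem continuous_integral_slice {f : E4 → ℝ} (hf : Continuous f) {ρ : ℝ}
    (h0 : ∀ x, ρ < E4.spatialNorm x → f x = 0) :
    Continuous fun t : ℝ ↦ ∫ y, f (E4.ofTimeSpace t y) := by
  have h : (fun t : ℝ ↦ ∫ y, f (E4.ofTimeSpace t y)) =
      fun t ↦ ∫ y in closedBall (0 : E3) ρ, f (E4.ofTimeSpace t y) :=
    funext fun t ↦ integral_slice_eq_setIntegral h0 t
  rw [h]
  exact KerrSchild.Background.continuous_ballIntegral hf ρ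

/-- Young's inequality `ab ≤ (α/2) a² + b²/(2α)`, `α > 0`. [folklore] -/
theorem mul_le_young {α : ℝ} (hα : 0 < α) (a b : ℝ) :
    a * b ≤ α / 2 * a ^ 2 + b ^ 2 / (2 * α) := by
  have h : α / 2 * a ^ 2 + b ^ 2 / (2 * α) - a * b = (α * a - b) ^ 2 / (2 * α) := by
    field_simp
    ring
  have h2 : 0 ≤ (α * a - b) ^ 2 / (2 * α) := by positivity
  linarith

end Slices

/-! ### The core estimate: a lower bound for the coordinate energy, uniform in the time -/

/-- **Approximate conservation of the `∂_{t*}`-energy gives a lower bound for the coordinate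
energy which is uniform in `T`.** Let `0 ≤ M`, `2M < r₁`, and let `w ∈ C²(E4)` be such that near
every point either `w` vanishes identically or the point has Kerr–Schild radius `≥ r₁` and
`‖x⃗‖ ≤ ρ` (a function supported in a compact part of `{r ≥ r₁}`, off the ergoregion). Put
`κ = ½ − M/r₁ > 0`, `E(t) = ∫ ∑_μ (∂_μw)²(t, y) dy`. If `∫_{(0,T]} ∫ (□_g w)² ≤ μ`, `e₁ ≤ E(0)` and
`μ (T + 1)(1/κ² + 1/4) ≤ κ e₁ / 2`, then `E(τ) ≥ κ e₁ / 4` for all `0 ≤ τ ≤ T`. Proof: the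
`∂_{t*}`-energy `F = ∫ −(J^T)⁰` satisfies `κ E ≤ F ≤ E` (pointwise, `H ≤ M/r ≤ M/r₁ < ½`) and
`F(τ) − F(0) = −∫∫ □_g w ∂₀w` (`integral_tCurrent_sub_eq`), which is bounded by Young's inequality
and a bootstrap on `sup_{[0,T]} F`. This replaces, for beams supported off the ergoregion, the
energy characterisation of Sbierski's §4 ("in the presence of a globally timelike Killing vector
field one can already infer such obstructions from (1.2), since the (canonical) energy … is then
constant", Anal. PDE 8 (2015), §1.2). [cite: Sbierski2015, §1.2 (last paragraph) and §2 proof of Thm. 2.1] -/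
theorem sliceEnergy_lower_bound_of_tEnergy {M a r₁ ρ : ℝ} (hM : 0 ≤ M) (hr₁ : 2 * M < r₁)
    (hr₁0 : 0 < r₁) {w : E4 → ℝ} (hw : ContDiff ℝ 2 w)
    (hsupp : ∀ x, (w =ᶠ[𝓝 x] fun _ ↦ 0) ∨ (r₁ ≤ Kerr.radius a x ∧ E4.spatialNorm x ≤ ρ))
    {T μ e₁ : ℝ} (hT : 0 ≤ T)
    (hbox : ∫ t in Set.Ioc 0 T, ∫ y,
      KerrSchild.waveOperator (Kerr.inverseMetric M a) w (E4.ofTimeSpace t y) ^ 2 ≤ μ)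
    (he₁ : e₁ ≤ ∫ y, ∑ μ, fderiv ℝ w (E4.ofTimeSpace 0 y) (E4.basisVector μ) ^ 2)
    (hsmall : μ * ((T + 1) * (1 / (2⁻¹ - M / r₁) ^ 2 + 1 / 4)) ≤ (2⁻¹ - M / r₁) * e₁ / 2)
    {τ : ℝ} (hτ0 : 0 ≤ τ) (hτT : τ ≤ T) :
    (2⁻¹ - M / r₁) * e₁ / 4 ≤ ∫ y, ∑ μ, fderiv ℝ w (E4.ofTimeSpace τ y) (E4.basisVector μ) ^ 2 := by
  -- ### notation and positivity of `κ`
  set κ : ℝ := 2⁻¹ - M / r₁ with hκ_def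
  have hMr : M / r₁ < 2⁻¹ := by rw [div_lt_iff₀ hr₁0]; linarith
  have hκ : 0 < κ := by rw [hκ_def]; linarith
  have hκle : κ ≤ 2⁻¹ := by rw [hκ_def]; linarith [div_nonneg hM hr₁0.le]
  set G : E4 → Fin 4 → Fin 4 → ℝ := Kerr.inverseMetric M a with hG
  set dens : E4 → ℝ := fun x ↦ ∑ μ, fderiv ℝ w x (E4.basisVector μ) ^ 2 with hdens
  set jT : E4 → ℝ := fun x ↦ -Kerr.tCurrent M a w x 0 with hjT
  set bx : E4 → ℝ := fun x ↦ KerrSchild.waveOperator G w x with hbx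
  set p0 : E4 → ℝ := fun x ↦ fderiv ℝ w x (E4.basisVector 0) with hp0
  set E : ℝ → ℝ := fun t ↦ ∫ y, dens (E4.ofTimeSpace t y) with hE
  set F : ℝ → ℝ := fun t ↦ ∫ y, jT (E4.ofTimeSpace t y) with hF
  set Bsq : ℝ → ℝ := fun t ↦ ∫ y, bx (E4.ofTimeSpace t y) ^ 2 with hBsq
  set P : ℝ → ℝ := fun t ↦ ∫ y, p0 (E4.ofTimeSpace t y) ^ 2 with hP
  -- ### derived support properties
  have hloc : ∀ x, (w =ᶠ[𝓝 x] fun _ ↦ 0) ∨ 0 < Kerr.radius a x := fun x ↦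
    (hsupp x).imp_right fun h ↦ hr₁0.trans_le h.1
  have hdw0 : ∀ x, (w =ᶠ[𝓝 x] fun _ ↦ 0) → fderiv ℝ w x = 0 := fun x h ↦ by
    rw [(show w =ᶠ[𝓝 x] fun _ ↦ 0 from h).fderiv_eq]; simp
  have hfar' : ∀ x, ρ < E4.spatialNorm x → w =ᶠ[𝓝 x] fun _ ↦ 0 := fun x hx ↦ by
    rcases hsupp x with h | h
    · exact h
    · exact absurd h.2 (not_le.2 hx)
  have hfar : ∀ x, ρ < E4.spatialNorm x → fderiv ℝ w x = 0 := fun x hx ↦ hdw0 x (hfar' x hx)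
  -- ### continuity of the densities and vanishing off the cylinder
  have hwc : ∀ ν, Continuous fun x ↦ fderiv ℝ w x (E4.basisVector ν) :=
    fun ν ↦ (KerrSchild.Background.contDiff_partial hw _).continuous
  have hdens_c : Continuous dens := continuous_finsetSum _ fun μ _ ↦ (hwc μ).pow 2
  have hjT_c : Continuous jT := (contDiff_tCurrent hw hloc 0).continuous.neg
  have hbx_c : Continuous bx := continuous_waveOperator_inverseMetric hw hloc
  have hp0_c : Continuous p0 := hwc 0
  have hdens0 : ∀ x, ρ < E4.spatialNorm x → dens x = 0 := fun x hx ↦ by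
    simp [hdens, hfar x hx]
  have hjT0 : ∀ x, ρ < E4.spatialNorm x → jT x = 0 := fun x hx ↦ by
    simp [hjT, Kerr.tCurrent, hfar x hx]
  have hbx0 : ∀ x, ρ < E4.spatialNorm x → bx x = 0 := fun x hx ↦
    waveOperator_eq_zero_of_eventuallyEq_zero (hfar' x hx)
  have hp00 : ∀ x, ρ < E4.spatialNorm x → p0 x = 0 := fun x hx ↦ by
    simp [hp0, hfar x hx]
  have hbx2_0 : ∀ x, ρ < E4.spatialNorm x → bx x ^ 2 = 0 := fun x hx ↦ by simp [hbx0 x hx]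
  have hp02_0 : ∀ x, ρ < E4.spatialNorm x → p0 x ^ 2 = 0 := fun x hx ↦ by simp [hp00 x hx]
  have hprod0 : ∀ x, ρ < E4.spatialNorm x → bx x * p0 x = 0 := fun x hx ↦ by simp [hp00 x hx]
  -- ### pointwise comparison `κ dens ≤ jT ≤ dens`
  have hcmp : ∀ x, κ * dens x ≤ jT x ∧ jT x ≤ dens x := by
    intro x
    rcases hsupp x with h | h
    · have hd : fderiv ℝ w x = 0 := hdw0 x h
      simp [hdens, hjT, Kerr.tCurrent, hd]
    · have hx : 0 < Kerr.radius a x := hr₁0.trans_le h.1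
      have hH : Kerr.scalarH M a x ≤ M / r₁ :=
        (Kerr.scalarH_le_div hM a hx).trans (div_le_div_of_nonneg_left hM hr₁0 h.1)
      refine ⟨?_, ?_⟩
      · calc κ * dens x ≤ (2⁻¹ - Kerr.scalarH M a x) * dens x :=
            mul_le_mul_of_nonneg_right (by rw [hκ_def]; linarith)
              (Finset.sum_nonneg fun _ _ ↦ sq_nonneg _)
          _ ≤ jT x := sub_scalarH_mul_sum_sq_le_neg_tCurrent_zero hM a w hx
      · exact neg_tCurrent_zero_le_sum_sq hM a w hx (hH.trans hMr.le)
  -- ### integrability and continuity of the slice integrals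
  have hE_int : ∀ t, Integrable fun y ↦ dens (E4.ofTimeSpace t y) :=
    fun t ↦ integrable_slice hdens_c hdens0 t
  have hF_int : ∀ t, Integrable fun y ↦ jT (E4.ofTimeSpace t y) :=
    fun t ↦ integrable_slice hjT_c hjT0 t
  have hBsq_int : ∀ t, Integrable fun y ↦ bx (E4.ofTimeSpace t y) ^ 2 :=
    fun t ↦ integrable_slice (f := fun x ↦ bx x ^ 2) (hbx_c.pow 2) hbx2_0 t
  have hP_int : ∀ t, Integrable fun y ↦ p0 (E4.ofTimeSpace t y) ^ 2 :=
    fun t ↦ integrable_slice (f := fun x ↦ p0 x ^ 2) (hp0_c.pow 2) hp02_0 t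
  have hprod_int : ∀ t, Integrable fun y ↦ bx (E4.ofTimeSpace t y) * p0 (E4.ofTimeSpace t y) :=
    fun t ↦ integrable_slice (f := fun x ↦ bx x * p0 x) (hbx_c.mul hp0_c) hprod0 t
  have hF_c : Continuous F := continuous_integral_slice hjT_c hjT0
  have hBsq_c : Continuous Bsq :=
    continuous_integral_slice (f := fun x ↦ bx x ^ 2) (hbx_c.pow 2) hbx2_0
  have hP_c : Continuous P := continuous_integral_slice (f := fun x ↦ p0 x ^ 2) (hp0_c.pow 2) hp02_0
  have hprod_c : Continuous fun t : ℝ ↦ ∫ y, bx (E4.ofTimeSpace t y) * p0 (E4.ofTimeSpace t y) :=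
    continuous_integral_slice (f := fun x ↦ bx x * p0 x) (hbx_c.mul hp0_c) hprod0
  -- ### integrated comparisons
  have hEF : ∀ t, κ * E t ≤ F t ∧ F t ≤ E t := fun t ↦ by
    refine ⟨?_, ?_⟩
    · rw [hE, ← integral_const_mul]
      exact integral_mono ((hE_int t).const_mul κ) (hF_int t) fun y ↦ (hcmp _).1
    · exact integral_mono (hF_int t) (hE_int t) fun y ↦ (hcmp _).2
  have hPE : ∀ t, P t ≤ E t := fun t ↦
    integral_mono (hP_int t) (hE_int t) fun y ↦
      Finset.single_le_sum (f := fun μ ↦ fderiv ℝ w (E4.ofTimeSpace t y) (E4.basisVector μ) ^ 2)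
        (fun _ _ ↦ sq_nonneg _) (Finset.mem_univ 0)
  have hBsq0 : ∀ t, 0 ≤ Bsq t := fun t ↦ integral_nonneg fun _ ↦ sq_nonneg _
  have hF0 : ∀ t, 0 ≤ F t := fun t ↦
    ((mul_nonneg hκ.le (integral_nonneg fun _ ↦ Finset.sum_nonneg fun _ _ ↦ sq_nonneg _)).trans
      (hEF t).1)
  -- ### the identity `F σ − F 0 = −∫∫ □w ∂₀w`
  have hident : ∀ σ, 0 ≤ σ → F σ - F 0 =
      -∫ t in Set.Ioc 0 σ, ∫ y, bx (E4.ofTimeSpace t y) * p0 (E4.ofTimeSpace t y) := by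
    intro σ hσ
    have h := integral_tCurrent_sub_eq (M := M) (a := a) hw hloc hfar hσ
    have hFσ : ∀ s, F s = -∫ y, Kerr.tCurrent M a w (E4.ofTimeSpace s y) 0 := fun s ↦ by
      rw [hF, ← integral_neg]
    rw [hFσ σ, hFσ 0, ← h]
    ring
  -- ### the supremum of `F` on `[0, T]`
  set Fmax : ℝ := sSup (F '' Set.Icc 0 T) with hFmax
  have hbdd : BddAbove (F '' Set.Icc 0 T) := (isCompact_Icc.image hF_c).bddAbove
  have hne : (F '' Set.Icc 0 T).Nonempty := ⟨F 0, 0, ⟨le_rfl, hT⟩, rfl⟩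
  have hle_max : ∀ t ∈ Set.Icc 0 T, F t ≤ Fmax := fun t ht ↦ le_csSup hbdd ⟨t, ht, rfl⟩
  have hFmax0 : 0 ≤ Fmax := (hF0 0).trans (hle_max 0 ⟨le_rfl, hT⟩)
  -- ### Young: `|∫_{(0,σ]} ∫ □w ∂₀w| ≤ (α/2) μ + T Fmax / (2 α κ)` for `σ ∈ [0, T]`, `α > 0`
  have hyoung : ∀ α : ℝ, 0 < α → ∀ σ ∈ Set.Icc 0 T,
      |∫ t in Set.Ioc 0 σ, ∫ y, bx (E4.ofTimeSpace t y) * p0 (E4.ofTimeSpace t y)| ≤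
        α / 2 * μ + T * Fmax / (2 * α * κ) := by
    intro α hα σ hσ
    -- pointwise in `t`: `|∫ □w ∂₀w| ≤ α/2 Bsq t + P t / (2α)`
    have hslice : ∀ t, |∫ y, bx (E4.ofTimeSpace t y) * p0 (E4.ofTimeSpace t y)| ≤
        α / 2 * Bsq t + P t / (2 * α) := by
      intro t
      have hi1 : Integrable fun y ↦ α / 2 * bx (E4.ofTimeSpace t y) ^ 2 := (hBsq_int t).const_mul _
      have hi2 : Integrable fun y ↦ p0 (E4.ofTimeSpace t y) ^ 2 / (2 * α) := (hP_int t).div_const _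
      have hrhs : ∫ y, (α / 2 * bx (E4.ofTimeSpace t y) ^ 2 + p0 (E4.ofTimeSpace t y) ^ 2 / (2 * α)) =
          α / 2 * Bsq t + P t / (2 * α) := by
        have hB' : ∫ y, α / 2 * bx (E4.ofTimeSpace t y) ^ 2 = α / 2 * Bsq t :=
          integral_const_mul _ _
        have hP' : ∫ y, p0 (E4.ofTimeSpace t y) ^ 2 / (2 * α) = P t / (2 * α) := integral_div _ _
        rw [integral_add hi1 hi2, hB', hP']
      rw [abs_le, ← hrhs]
      refine ⟨neg_le.1 ?_, ?_⟩
      · rw [← integral_neg]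
        refine integral_mono (hprod_int t).neg (hi1.add hi2) fun y ↦ ?_
        have h := mul_le_young hα (-bx (E4.ofTimeSpace t y)) (p0 (E4.ofTimeSpace t y))
        rw [neg_mul, neg_sq] at h
        exact h
      · exact integral_mono (hprod_int t) (hi1.add hi2) fun y ↦ mul_le_young hα _ _
    -- integrate in `t ∈ (0, σ]`
    have hIoc : IntegrableOn (fun t ↦ α / 2 * Bsq t + P t / (2 * α)) (Set.Ioc 0 σ) :=
      (((continuous_const.mul hBsq_c).add (hP_c.div_const _)).integrableOn_Icc).mono_set
        Set.Ioc_subset_Icc_self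
    have h1 : |∫ t in Set.Ioc 0 σ, ∫ y, bx (E4.ofTimeSpace t y) * p0 (E4.ofTimeSpace t y)| ≤
        ∫ t in Set.Ioc 0 σ, (α / 2 * Bsq t + P t / (2 * α)) :=
      (abs_integral_le_integral_abs).trans
        (setIntegral_mono_on (hprod_c.integrableOn_Icc.mono_set Set.Ioc_subset_Icc_self).abs
          hIoc measurableSet_Ioc fun t _ ↦ hslice t)
    have h2 : ∫ t in Set.Ioc 0 σ, (α / 2 * Bsq t + P t / (2 * α)) =
        α / 2 * (∫ t in Set.Ioc 0 σ, Bsq t) + (∫ t in Set.Ioc 0 σ, P t) / (2 * α) := by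
      have hB' : ∫ t in Set.Ioc 0 σ, α / 2 * Bsq t = α / 2 * ∫ t in Set.Ioc 0 σ, Bsq t :=
        integral_const_mul _ _
      have hP' : ∫ t in Set.Ioc 0 σ, P t / (2 * α) = (∫ t in Set.Ioc 0 σ, P t) / (2 * α) :=
        integral_div _ _
      rw [integral_add ((hBsq_c.integrableOn_Icc.mono_set Set.Ioc_subset_Icc_self).const_mul _)
        ((hP_c.integrableOn_Icc.mono_set Set.Ioc_subset_Icc_self).div_const _), hB', hP']
    -- `∫_{(0,σ]} Bsq ≤ μ`
    have h3 : ∫ t in Set.Ioc 0 σ, Bsq t ≤ μ :=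
      (setIntegral_mono_set (hBsq_c.integrableOn_Icc.mono_set Set.Ioc_subset_Icc_self)
        (ae_of_all _ fun t ↦ hBsq0 t)
        (ae_of_all _ (Set.Ioc_subset_Ioc_right hσ.2))).trans hbox
    -- `∫_{(0,σ]} P ≤ σ Fmax / κ ≤ T Fmax / κ`
    have h4 : ∫ t in Set.Ioc 0 σ, P t ≤ T * Fmax / κ := by
      have hPle : ∀ t ∈ Set.Ioc 0 σ, P t ≤ Fmax / κ := fun t ht ↦ by
        have ht' : t ∈ Set.Icc 0 T := ⟨ht.1.le, ht.2.trans hσ.2⟩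
        rw [le_div_iff₀ hκ]
        calc P t * κ = κ * P t := mul_comm _ _
          _ ≤ κ * E t := mul_le_mul_of_nonneg_left (hPE t) hκ.le
          _ ≤ F t := (hEF t).1
          _ ≤ Fmax := hle_max t ht'
      calc ∫ t in Set.Ioc 0 σ, P t ≤ ∫ t in Set.Ioc 0 σ, Fmax / κ :=
            setIntegral_mono_on (hP_c.integrableOn_Icc.mono_set Set.Ioc_subset_Icc_self)
              (continuous_const.integrableOn_Icc.mono_set Set.Ioc_subset_Icc_self)
              measurableSet_Ioc hPle
        _ = σ * (Fmax / κ) := by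
            rw [setIntegral_const, Real.volume_real_Ioc, sub_zero, max_eq_left hσ.1, smul_eq_mul]
        _ ≤ T * (Fmax / κ) := mul_le_mul_of_nonneg_right hσ.2 (div_nonneg hFmax0 hκ.le)
        _ = T * Fmax / κ := by ring
    calc |∫ t in Set.Ioc 0 σ, ∫ y, bx (E4.ofTimeSpace t y) * p0 (E4.ofTimeSpace t y)|
        ≤ α / 2 * (∫ t in Set.Ioc 0 σ, Bsq t) + (∫ t in Set.Ioc 0 σ, P t) / (2 * α) := by
          rw [← h2]; exact h1
      _ ≤ α / 2 * μ + (T * Fmax / κ) / (2 * α) :=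
          add_le_add (mul_le_mul_of_nonneg_left h3 (by positivity : (0 : ℝ) ≤ α / 2))
            (div_le_div_of_nonneg_right h4 (by positivity : (0 : ℝ) ≤ 2 * α))
      _ = α / 2 * μ + T * Fmax / (2 * α * κ) := by
          rw [div_div, mul_comm κ (2 * α)]
  -- ### bootstrap: `Fmax ≤ 2 F 0 + (T + 1) μ / κ`
  have hFmax_le : Fmax ≤ 2 * F 0 + (T + 1) * μ / κ := by
    have hα : 0 < (T + 1) / κ := by positivity
    have hup : ∀ σ ∈ Set.Icc 0 T, F σ ≤ F 0 + (T + 1) * μ / (2 * κ) + Fmax / 2 := by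
      intro σ hσ
      have hy := hyoung _ hα σ hσ
      have hid := hident σ hσ.1
      have hT1 : T * Fmax / (2 * ((T + 1) / κ) * κ) ≤ Fmax / 2 := by
        have hden : 2 * ((T + 1) / κ) * κ = 2 * (T + 1) := by
          rw [mul_assoc, div_mul_cancel₀ _ hκ.ne']
        rw [hden, div_le_div_iff₀ (by positivity) two_pos]
        nlinarith
      have hαμ : (T + 1) / κ / 2 * μ = (T + 1) * μ / (2 * κ) := by ring
      rw [hαμ] at hy
      linarith [(abs_le.1 hy).1, (abs_le.1 hy).2]
    have h := csSup_le hne (by rintro _ ⟨σ, hσ, rfl⟩; exact hup σ hσ)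
    have h' : Fmax ≤ F 0 + (T + 1) * μ / (2 * κ) + Fmax / 2 := h
    have : (T + 1) * μ / (2 * κ) = ((T + 1) * μ / κ) / 2 := by ring
    linarith
  -- ### the lower bound for `F τ`
  have hlow : κ * e₁ / 4 ≤ F τ := by
    have hβ : 0 < 2 * (T + 1) / κ ^ 2 := by positivity
    have hy := hyoung _ hβ τ ⟨hτ0, hτT⟩
    have hid := hident τ hτ0
    -- the two error terms
    have herr1 : 2 * (T + 1) / κ ^ 2 / 2 * μ = (T + 1) * μ / κ ^ 2 := by ring
    have herr2 : T * Fmax / (2 * (2 * (T + 1) / κ ^ 2) * κ) ≤ κ * Fmax / 4 := by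
      have hden : 2 * (2 * (T + 1) / κ ^ 2) * κ = 4 * (T + 1) / κ := by
        rw [eq_div_iff hκ.ne']
        field_simp
        ring
      rw [hden, div_div_eq_mul_div, div_le_div_iff₀ (by positivity) (by norm_num : (0 : ℝ) < 4)]
      nlinarith [mul_nonneg hκ.le hFmax0, mul_nonneg (mul_nonneg hκ.le hFmax0) hT]
    rw [herr1] at hy
    have hFτ : F 0 - (T + 1) * μ / κ ^ 2 - κ * Fmax / 4 ≤ F τ := by
      linarith [(abs_le.1 hy).1, (abs_le.1 hy).2]
    -- `F 0 ≥ κ e₁`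
    have hF0e : κ * e₁ ≤ F 0 := (mul_le_mul_of_nonneg_left he₁ hκ.le).trans (hEF 0).1
    -- combine with the bootstrap and the smallness of `μ`
    have hsm : μ * ((T + 1) * (1 / κ ^ 2 + 1 / 4)) ≤ κ * e₁ / 2 := hsmall
    have hexp : μ * ((T + 1) * (1 / κ ^ 2 + 1 / 4)) = (T + 1) * μ / κ ^ 2 + (T + 1) * μ / 4 := by
      ring
    rw [hexp] at hsm
    have hk4 : κ * Fmax / 4 ≤ κ * (2 * F 0 + (T + 1) * μ / κ) / 4 := by
      gcongr
    have hk5 : κ * (2 * F 0 + (T + 1) * μ / κ) / 4 = κ * F 0 / 2 + (T + 1) * μ / 4 := by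
      rw [mul_add, mul_div_cancel₀ _ hκ.ne']
      ring
    nlinarith [hF0 0, mul_nonneg hκ.le (hF0 0)]
  exact hlow.trans (hEF τ).2


/-! ### From the chart to `E4`: support, energies and the slab norm of chart-supported functions -/

section Conversions

variable {U : TopologicalSpace.Opens E4}

/-- A function on the chart vanishing off a compact `S` has a zero extension which, near every
point of `E4`, either vanishes identically or sits at a point of (the image of) `S`. [folklore] -/
theorem extend_val_eventuallyEq_zero_or {u : U → ℝ} {S : Set U} (hS : IsCompact S)
    (h0 : ∀ x, x ∉ S → u x = 0) {P : E4 → Prop} (hP : ∀ x ∈ S, P (x : E4)) (x : E4) :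
    (Function.extend Subtype.val u (0 : E4 → ℝ) =ᶠ[𝓝 x] fun _ ↦ 0) ∨ P x := by
  by_cases hx : x ∈ Subtype.val '' S
  · obtain ⟨z, hz, rfl⟩ := hx
    exact Or.inr (hP z hz)
  · exact Or.inl (extend_val_eventuallyEq_zero hS h0 hx)

/-- **The coordinate energy through `{t* = τ}` as a real integral**: for `u` on the chart whose
zero extension `ũ` is `C¹` and, near every point, either vanishes identically or sits in
`U ∩ {‖x⃗‖ ≤ ρ}`, `sliceEnergy U u τ = ∫ ∑_μ (∂_μ ũ)²(τ, y) dy`. [folklore] -/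
theorem sliceEnergy_eq_ofReal_integral {u : U → ℝ} {ρ : ℝ}
    (hub : ContDiff ℝ 1 (Function.extend Subtype.val u (0 : E4 → ℝ)))
    (halt : ∀ x, (Function.extend Subtype.val u (0 : E4 → ℝ) =ᶠ[𝓝 x] fun _ ↦ 0) ∨
      (x ∈ (U : Set E4) ∧ E4.spatialNorm x ≤ ρ)) (τ : ℝ) :
    sliceEnergy U u τ = ENNReal.ofReal (∫ y, ∑ μ,
      fderiv ℝ (Function.extend Subtype.val u (0 : E4 → ℝ)) (E4.ofTimeSpace τ y)
        (E4.basisVector μ) ^ 2) := by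
  set ub := Function.extend Subtype.val u (0 : E4 → ℝ) with hub_def
  have hd0 : ∀ x, (ub =ᶠ[𝓝 x] fun _ ↦ 0) → fderiv ℝ ub x = 0 := fun x h ↦ by
    rw [(show ub =ᶠ[𝓝 x] fun _ ↦ 0 from h).fderiv_eq]; simp
  have hdens_c : Continuous fun x ↦ ∑ μ, fderiv ℝ ub x (E4.basisVector μ) ^ 2 :=
    continuous_finsetSum _ fun μ _ ↦
      ((hub.continuous_fderiv one_ne_zero).clm_apply continuous_const).pow 2
  have hdens0 : ∀ x, ρ < E4.spatialNorm x → ∑ μ, fderiv ℝ ub x (E4.basisVector μ) ^ 2 = 0 := by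
    intro x hx
    rcases halt x with h | h
    · simp [hd0 x h]
    · exact absurd h.2 (not_le.2 hx)
  have hint := integrable_slice hdens_c hdens0 τ
  have hpt : ∀ y : E3, Set.indicator {y : E3 | E4.ofTimeSpace τ y ∈ U}
      (fun y ↦ ENNReal.ofReal (coordEnergyDensity U u (E4.ofTimeSpace τ y))) y =
        ENNReal.ofReal (∑ μ, fderiv ℝ ub (E4.ofTimeSpace τ y) (E4.basisVector μ) ^ 2) := by
    intro y
    by_cases hy : E4.ofTimeSpace τ y ∈ U
    · rw [Set.indicator_of_mem (show y ∈ {y : E3 | E4.ofTimeSpace τ y ∈ U} from hy),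
        ← Kerr.sum_sq_fderiv_extend_eq]
    · rw [Set.indicator_of_notMem (show y ∉ {y : E3 | E4.ofTimeSpace τ y ∈ U} from hy)]
      rcases halt (E4.ofTimeSpace τ y) with h | h
      · simp [hd0 _ h]
      · exact absurd h.1 hy
  unfold sliceEnergy
  rw [lintegral_congr hpt]
  exact (ofReal_integral_eq_lintegral_ofReal hint
    (ae_of_all _ fun y ↦ Finset.sum_nonneg fun _ _ ↦ sq_nonneg _)).symm

/-- Under the same hypotheses the local energy in any ball of radius `R ≥ ρ` is the whole slice
energy. [folklore] -/
theorem localSliceEnergy_eq_sliceEnergy_of_support {u : U → ℝ} {ρ R : ℝ} (hρR : ρ ≤ R)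
    (halt : ∀ x, (Function.extend Subtype.val u (0 : E4 → ℝ) =ᶠ[𝓝 x] fun _ ↦ 0) ∨
      (x ∈ (U : Set E4) ∧ E4.spatialNorm x ≤ ρ)) (τ : ℝ) :
    localSliceEnergy U u τ R = sliceEnergy U u τ := by
  unfold localSliceEnergy sliceEnergy
  refine setLIntegral_eq_of_support_subset fun y hy ↦ ?_
  by_contra hyR
  rw [Metric.mem_closedBall, dist_zero_right, not_le] at hyR
  apply hy
  rcases halt (E4.ofTimeSpace τ y) with h | h
  · by_cases hyU : E4.ofTimeSpace τ y ∈ U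
    · rw [Set.indicator_of_mem (show y ∈ {y : E3 | E4.ofTimeSpace τ y ∈ U} from hyU),
        ← Kerr.sum_sq_fderiv_extend_eq]
      have hd : fderiv ℝ (Function.extend Subtype.val u (0 : E4 → ℝ)) (E4.ofTimeSpace τ y) = 0 := by
        rw [(show _ =ᶠ[𝓝 _] fun _ ↦ (0 : ℝ) from h).fderiv_eq]; simp
      simp [hd]
    · rw [Set.indicator_of_notMem (show y ∉ {y : E3 | E4.ofTimeSpace τ y ∈ U} from hyU)]
  · have : E4.spatialNorm (E4.ofTimeSpace τ y) ≤ ρ := h.2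
    rw [E4.spatialNorm_ofTimeSpace] at this
    exact absurd (hρR.trans_lt hyR) (not_lt.2 this)

variable [Kerr.Facts] [Kerr.SliceFacts] {M a : ℝ}

/-- **The slab norm of `□_g u` as an iterated real integral**: for `u ∈ C^∞` on the Kerr
exterior whose zero extension `ũ` is `C²` and, near every point, vanishes identically or sits in
the chart with `‖x⃗‖ ≤ ρ`, the bound `slabSqNorm (□_g u) T ≤ μ` gives
`∫_{(0,T]} ∫ (□_g ũ)²(t, y) dy dt ≤ μ`, where `□_g ũ = ∑_μ ∂_μ(g^{μν} ∂_ν ũ)` is the coordinate wave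
operator (`Kerr.dalembertian_eq_divergence`). [cite: Sbierski2015, §2 proof of Thm. 2.1 (first condition)] -/
theorem integral_waveOperator_sq_le_of_slabSqNorm_le {u : Kerr.exterior M a → ℝ} {ρ : ℝ}
    (hub : ContDiff ℝ 2 (Function.extend Subtype.val u (0 : E4 → ℝ)))
    (halt : ∀ x, (Function.extend Subtype.val u (0 : E4 → ℝ) =ᶠ[𝓝 x] fun _ ↦ 0) ∨
      (x ∈ (Kerr.exterior M a : Set E4) ∧ E4.spatialNorm x ≤ ρ))
    {T μ : ℝ} (hμ : 0 ≤ μ)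
    (hbox : slabSqNorm (Kerr.exterior M a) (fun x ↦
      (Kerr.smoothMetric M a (Kerr.rPlus M a)).toPseudoRiemannianMetric.dalembertian u x) T ≤
        ENNReal.ofReal μ) :
    ∫ t in Set.Ioc 0 T, ∫ y, KerrSchild.waveOperator (Kerr.inverseMetric M a)
      (Function.extend Subtype.val u (0 : E4 → ℝ)) (E4.ofTimeSpace t y) ^ 2 ≤ μ := by
  set ub := Function.extend Subtype.val u (0 : E4 → ℝ) with hub_def
  set wO : E4 → ℝ := KerrSchild.waveOperator (Kerr.inverseMetric M a) ub with hwO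
  have hrep : ∀ y : Kerr.exterior M a, u y = ub y := fun y ↦ (extend_val_apply u y).symm
  have hloc : ∀ x, (ub =ᶠ[𝓝 x] fun _ ↦ 0) ∨ 0 < Kerr.radius a x := fun x ↦
    (halt x).imp_right fun h ↦ Kerr.radius_pos_of_mem_region h.1
  have hwO_c : Continuous wO := continuous_waveOperator_inverseMetric hub hloc
  have hwO0 : ∀ x, ρ < E4.spatialNorm x → wO x = 0 := fun x hx ↦ by
    rcases halt x with h | h
    · exact waveOperator_eq_zero_of_eventuallyEq_zero h
    · exact absurd h.2 (not_le.2 hx)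
  have hwO2_0 : ∀ x, ρ < E4.spatialNorm x → wO x ^ 2 = 0 := fun x hx ↦ by simp [hwO0 x hx]
  set Bsq : ℝ → ℝ := fun t ↦ ∫ y, wO (E4.ofTimeSpace t y) ^ 2 with hBsq
  have hBsq_c : Continuous Bsq :=
    continuous_integral_slice (f := fun x ↦ wO x ^ 2) (hwO_c.pow 2) hwO2_0
  have hBsq_int : ∀ t, Integrable fun y ↦ wO (E4.ofTimeSpace t y) ^ 2 := fun t ↦
    integrable_slice (f := fun x ↦ wO x ^ 2) (hwO_c.pow 2) hwO2_0 t
  have hBsq0 : ∀ t, 0 ≤ Bsq t := fun t ↦ integral_nonneg fun _ ↦ sq_nonneg _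
  -- `□_g u = □ ũ` on the chart
  have hchart : ∀ x : Kerr.exterior M a, Function.extend Subtype.val (fun x ↦
      (Kerr.smoothMetric M a (Kerr.rPlus M a)).toPseudoRiemannianMetric.dalembertian u x)
        (0 : E4 → ℝ) x = wO x := fun x ↦ by
    rw [extend_val_apply]
    exact Kerr.dalembertian_eq_divergence M a (Kerr.rPlus M a) hrep x hub.contDiffAt
  -- pointwise comparison of the integrands
  have hmeasT : MeasurableSet {x : E4 | x 0 ∈ Set.Icc 0 T} :=
    (E4.dx 0).continuous.measurable measurableSet_Icc
  have hpt : ∀ x : E4, Set.indicator {x : E4 | x 0 ∈ Set.Icc 0 T}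
      (fun x ↦ ENNReal.ofReal (wO x ^ 2)) x ≤
        Set.indicator {x : E4 | x ∈ (Kerr.exterior M a : Set E4) ∧ 0 ≤ x 0 ∧ x 0 ≤ T}
          (fun x ↦ ENNReal.ofReal (Function.extend Subtype.val (fun x ↦
            (Kerr.smoothMetric M a (Kerr.rPlus M a)).toPseudoRiemannianMetric.dalembertian u x)
              (0 : E4 → ℝ) x ^ 2)) x := by
    intro x
    by_cases hxt : x ∈ {x : E4 | x 0 ∈ Set.Icc 0 T}
    · rw [Set.indicator_of_mem hxt]
      by_cases hxU : x ∈ (Kerr.exterior M a : Set E4)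
      · rw [Set.indicator_of_mem (show x ∈ {x : E4 | x ∈ (Kerr.exterior M a : Set E4) ∧
          0 ≤ x 0 ∧ x 0 ≤ T} from ⟨hxU, hxt.1, hxt.2⟩), hchart ⟨x, hxU⟩]
      · have hx0 : wO x = 0 := by
          rcases halt x with h | h
          · exact waveOperator_eq_zero_of_eventuallyEq_zero h
          · exact absurd h.1 hxU
        rw [hx0]
        simp
    · rw [Set.indicator_of_notMem hxt]
      exact zero_le
  -- the slab integral of `(□ũ)²` as an iterated integral
  have hmeas : Measurable fun x ↦ ENNReal.ofReal (wO x ^ 2) :=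
    ENNReal.measurable_ofReal.comp (hwO_c.pow 2).measurable
  have hiter : ∫⁻ x in {x : E4 | x 0 ∈ Set.Icc 0 T}, ENNReal.ofReal (wO x ^ 2) =
      ENNReal.ofReal (∫ t in Set.Ioc 0 T, Bsq t) := by
    rw [E4.setLIntegral_timeSlab_eq _ hmeas measurableSet_Icc]
    have hin : ∀ t, ∫⁻ y, ENNReal.ofReal (wO (E4.ofTimeSpace t y) ^ 2) =
        ENNReal.ofReal (Bsq t) := fun t ↦
      (ofReal_integral_eq_lintegral_ofReal (hBsq_int t) (ae_of_all _ fun _ ↦ sq_nonneg _)).symm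
    simp_rw [hin]
    rw [← ofReal_integral_eq_lintegral_ofReal hBsq_c.integrableOn_Icc
      (ae_of_all _ fun t ↦ hBsq0 t), integral_Icc_eq_integral_Ioc]
  have hle : ENNReal.ofReal (∫ t in Set.Ioc 0 T, Bsq t) ≤ ENNReal.ofReal μ := by
    rw [← hiter, ← lintegral_indicator hmeasT]
    exact (lintegral_mono hpt).trans hbox
  exact (ENNReal.ofReal_le_ofReal_iff hμ).1 hle

end Conversions

/-! ### (B) from weak beams: approximate solutions supported off the ergoregion with two-sided
initial energy -/

/-- **Sbierski's coordinate-energy beams (B) `SbierskiKerrGaussianBeams` from "weak beams".**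
Suppose that for `0 < M`, `0 ≤ a ≤ M` there are `r₁ > 2M`, `R₁` and `0 < e₁`, `e₂` such that for
every `T ≥ 0` and every accuracy `μ > 0` some `C^∞` function `u` on the exterior chart, vanishing
off a compact subset of `{r ≥ r₁} ∩ {‖x⃗‖ ≤ R₁}` of the chart, has
`‖□_g u‖²_{L²(R_{[0,T]})} ≤ μ` and initial coordinate energy `e₁ ≤ E(0) ≤ e₂` — the three
conditions of the proof of Thm. 2.1 of Sbierski (Anal. PDE 8 (2015)) for the normalised beams
`ũ_λ = u_λ/√E₀` (first condition `‖□ũ_λ‖ → 0`, the normalisation, and support in a compact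
neighbourhood of the geodesic), *without* the energy characterisation of §4, but with supports off
the ergoregion. Then (B) holds, with `R₀ = R₁ + 1`, `c = (½ − M/r₁) e₁ / 4`, `C = e₂`: the lower
bound for the local energy at the later times is the approximate conservation of the energy of
the Killing field `∂_{t*}`, timelike on `{r > 2M}` (`sliceEnergy_lower_bound_of_tEnergy`), the
accuracy being chosen after `T` as in the printed proof. This is the Killing-energy shortcut that
Sbierski describes for Schwarzschild (§1.2: with a timelike Killing field "one can easily infer
from (1.2) alone that an LED statement in Schwarzschild has to lose differentiability"), which
applies on Kerr to beams supported in `{r ≥ r₁}`, `r₁ > 2M` — e.g. along the retrograde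
equatorial photon orbit `r₀ ∈ [3M, 4M]` of §7A (`Kerr.photonOrbitRadius`). With
`SbierskiTrappingObstruction.of_waveCauchyProblem_of_gaussianBeams` the trapping barrier thus
needs, besides the Cauchy problem, only such weak beams.
[cite: Sbierski2015, §1.2 and §2 proof of Thm. 2.1 (three conditions)] -/
theorem SbierskiKerrGaussianBeams.of_weakBeams
    (h : ∀ [Kerr.Facts] [Kerr.SliceFacts] (M a : ℝ), 0 < M → 0 ≤ a → a ≤ M →
      ∃ r₁ R₁ e₁ e₂ : ℝ, 2 * M < r₁ ∧ 0 < e₁ ∧ ∀ T : ℝ, 0 ≤ T → ∀ μ : ℝ, 0 < μ →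
        ∃ u : Kerr.exterior M a → ℝ,
          ContMDiff 𝓘(ℝ, E4) 𝓘(ℝ, ℝ) ∞ u ∧
          (∃ S : Set (Kerr.exterior M a), IsCompact S ∧ (∀ x, x ∉ S → u x = 0) ∧
            ∀ x ∈ S, r₁ ≤ Kerr.radius a (x : E4) ∧ E4.spatialNorm (x : E4) ≤ R₁) ∧
          slabSqNorm (Kerr.exterior M a) (fun x ↦
              (Kerr.smoothMetric M a (Kerr.rPlus M a)).toPseudoRiemannianMetric.dalembertian u x)
            T ≤ ENNReal.ofReal μ ∧
          ENNReal.ofReal e₁ ≤ sliceEnergy (Kerr.exterior M a) u 0 ∧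
          sliceEnergy (Kerr.exterior M a) u 0 ≤ ENNReal.ofReal e₂) :
    SbierskiKerrGaussianBeams := by
  intro _ _ M a hM ha₀ haM
  obtain ⟨r₁, R₁, e₁, e₂, hr₁, he₁, hT⟩ := h M a hM ha₀ haM
  have hr₁0 : 0 < r₁ := by linarith
  set κ : ℝ := 2⁻¹ - M / r₁ with hκ_def
  have hMr : M / r₁ < 2⁻¹ := by rw [div_lt_iff₀ hr₁0]; linarith
  have hκ : 0 < κ := by rw [hκ_def]; linarith
  refine ⟨R₁ + 1, fun R hR ↦ ⟨κ * e₁ / 4, e₂, by positivity, fun T hT0 ε hε ↦ ?_⟩⟩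
  -- ### the accuracy, chosen after `T`
  set D : ℝ := (T + 1) * (1 / κ ^ 2 + 1 / 4) with hD
  have hD0 : 0 < D := by positivity
  set μ : ℝ := min ε (κ * e₁ / 2 / D) with hμ_def
  have hμ0 : 0 < μ := lt_min hε (by positivity)
  have hμε : μ ≤ ε := min_le_left _ _
  have hμsmall : μ * D ≤ κ * e₁ / 2 := by
    calc μ * D ≤ κ * e₁ / 2 / D * D := mul_le_mul_of_nonneg_right (min_le_right _ _) hD0.le
      _ = κ * e₁ / 2 := div_mul_cancel₀ _ hD0.ne'
  obtain ⟨u, hu, ⟨S, hS, hsupp, hS1⟩, hbox, hE1, hE2⟩ := hT T hT0 μ hμ0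
  -- ### the zero extension and its support
  set ub := Function.extend Subtype.val u (0 : E4 → ℝ) with hub_def
  have hub : ContDiff ℝ ∞ ub := contDiff_extend_val hu hS hsupp
  have hub2 : ContDiff ℝ 2 ub := hub.of_le (by norm_cast)
  have hub1 : ContDiff ℝ 1 ub := hub.of_le (by norm_cast)
  have halt : ∀ x, (ub =ᶠ[𝓝 x] fun _ ↦ 0) ∨
      (x ∈ (Kerr.exterior M a : Set E4) ∧ E4.spatialNorm x ≤ R₁) :=
    extend_val_eventuallyEq_zero_or hS hsupp fun x hx ↦ ⟨x.2, (hS1 x hx).2⟩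
  have halt' : ∀ x, (ub =ᶠ[𝓝 x] fun _ ↦ 0) ∨ (r₁ ≤ Kerr.radius a x ∧ E4.spatialNorm x ≤ R₁) :=
    extend_val_eventuallyEq_zero_or hS hsupp fun x hx ↦ hS1 x hx
  have hvR : ∀ x : Kerr.exterior M a, R ≤ E4.spatialNorm (x : E4) → u x = 0 := fun x hx ↦
    hsupp x fun hxS ↦ by linarith [(hS1 x hxS).2]
  refine ⟨u, hu, ⟨S, hS, hsupp⟩, fun x _ hxR ↦ eq_zero_and_mfderiv_eq_zero_of_vanishing hvR hxR,
    hE2, hbox.trans (ENNReal.ofReal_le_ofReal hμε), fun τ hτ0 hτT ↦ ?_⟩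
  -- ### the lower bound for the local energy
  have hboxE4 := integral_waveOperator_sq_le_of_slabSqNorm_le hub2 halt hμ0.le hbox
  have hslice := fun σ ↦ sliceEnergy_eq_ofReal_integral hub1 halt σ
  have hE0_nonneg : 0 ≤ ∫ y, ∑ ν, fderiv ℝ ub (E4.ofTimeSpace 0 y) (E4.basisVector ν) ^ 2 :=
    integral_nonneg fun _ ↦ Finset.sum_nonneg fun _ _ ↦ sq_nonneg _
  have he₁' : e₁ ≤ ∫ y, ∑ ν, fderiv ℝ ub (E4.ofTimeSpace 0 y) (E4.basisVector ν) ^ 2 := by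
    rw [← ENNReal.ofReal_le_ofReal_iff hE0_nonneg, ← hslice 0]
    exact hE1
  have hcore := sliceEnergy_lower_bound_of_tEnergy (a := a) hM.le hr₁ hr₁0 hub2 halt' hT0
    hboxE4 he₁' hμsmall hτ0 hτT
  rw [localSliceEnergy_eq_sliceEnergy_of_support (by linarith : R₁ ≤ R) halt τ, hslice τ]
  exact ENNReal.ofReal_le_ofReal hcore

end Literature.Barriers.FinalStateConjecture

end
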